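import Literature.IUT.LogVolume.LatticeAutBalls
import HarnessLib

/-!
# Lattice automorphisms move norms by a bounded, `ℓ`-independent factor ([EssLgc] Example 3.5.1 (ii)–(iii))

PROOF-ONLY support file (pen draft by seat abc-iut-inv-2, MJ-HARVEST-2 rows A1–A3, crit-A verdict 2026-08-28T13:16:22Z
PASS-WITH-PRICE «land as a proof-only lemma file next to `LatticeAutBalls.lean`»). No new definition, no instance, no notation,
no hypothesis; standard axioms. TAKES NO SIDE on [IUTchIII] Cor. 3.12; nothing here bears on abc / Szpiro (width toward
`ThetaPartII` = 0, critic's pricing): the direction is EXCLUDING — automorphisms of a sandwiched lattice (the cell's (Ind2) shape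
`latticeAut`) cannot identify the region of `q` with that of `q^{j²}` past an explicit depth.

SOURCE. S. Mochizuki, *On the essential logical structure of inter-universal Teichmüller theory …* [EssLgc], Example 3.5.1
(ii)–(iii), p. 102 (both the RIMS-1968 2022 file and the 2024 version): «(ii) … there exists a positive integer s that depends only on
the isomorphism class of the field k such that for any automorphism φ : 𝓘_k ⥲ 𝓘_k of the ℤ_p-module 𝓘_k and any n ∈ ℤ, it holds that
φ(U(𝒪_k, n)) ⊆ ⋃_{i=−s}^{s} U(𝒪_k, n+i)»; «(iii) … there exists a positive integer t … such that … the absolute value of the difference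
between the orders of q and φ(q) is ≤ t»; and §3.5 (CnfInd1+2), p. 101: «such a "confusion" [between q-parameters and large positive
powers of these q-parameters] can never occur as a consequence of (Ind1), (Ind2)». Here: for ANY additive subgroup `Λ` of a normed
`ℚ_p`-algebra `K` with `closedBall 0 1 ⊆ Λ ⊆ closedBall 0 R` and any `φ ∈ latticeAut ℚ_[p] Λ`, `‖φ x‖ ≤ p·R·‖x‖` (so `t = s = 1 + log_p R`
in `p`-adic orders); hence balls move into balls of radius `p·R·r`, and for `j ≥ 2` with `‖q‖^{j²−1}·p·R < 1` the image of
`closedBall 0 ‖q‖^{j²}` is never `closedBall 0 ‖q‖`. The interface-level counterpart (hypothesis `H t` on log-volumes) is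
`Summit.ABC.IUTFork.Repair.CandExplicit8`; this file does NOT instantiate that interface (critic: a genuine `LatticeSituation` with
`Ind2Family = latticeAut` and Haar `logvol` would be a separate item). [cite: Mochizuki2022EssLgc, Ex. 3.5.1 (ii)–(iii) p. 102; §3.5 (CnfInd1+2) p. 101]
-/

noncomputable section

open Set Metric
open scoped Pointwise

namespace Literature.IUT.LogVolume

namespace LatticeAutDiscrepancy

variable (p : ℕ) [Fact p.Prime] {K : Type*} [NontriviallyNormedField K] [NormedAlgebra ℚ_[p] K]

/-- The sandwich `closedBall 0 1 ⊆ Λ ⊆ closedBall 0 R` forces `1 ≤ R` (`1 ∈ Λ`). [folklore] -/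
theorem one_le_of_sandwich {R : ℝ} {Λ : AddSubgroup K} (h1 : closedBall (0 : K) 1 ⊆ (Λ : Set K))
    (hR : (Λ : Set K) ⊆ closedBall (0 : K) R) : 1 ≤ R := by
  have h1mem : (1 : K) ∈ closedBall (0 : K) 1 := by simp
  have := hR (h1 h1mem)
  rwa [mem_closedBall, dist_zero_right, norm_one] at this

/-- **[EssLgc] Example 3.5.1 (iii), with the constant explicit and `ℓ`-independent**: an automorphism of a lattice sandwiched
`closedBall 0 1 ⊆ Λ ⊆ closedBall 0 R` moves norms by at most the factor `p·R`: `‖φ x‖ ≤ p·R·‖x‖`. Proof: rescale `x` by `p^k`,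
`k = clog_p ‖x‖`, into `closedBall 0 1 ⊆ Λ`, use `φ(Λ) = Λ ⊆ closedBall 0 R`.
[cite: Mochizuki2022EssLgc, Ex. 3.5.1 (iii) p. 102] -/
theorem norm_le_of_mem_latticeAut {R : ℝ} {Λ : AddSubgroup K} (h1 : closedBall (0 : K) 1 ⊆ (Λ : Set K))
    (hR : (Λ : Set K) ⊆ closedBall (0 : K) R) {φ : K ≃ₗ[ℚ_[p]] K} (hφ : φ ∈ latticeAut ℚ_[p] Λ.toIntSubmodule)
    (x : K) : ‖φ x‖ ≤ p * R * ‖x‖ := by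
  have hp1 : 1 < p := (Fact.out : p.Prime).one_lt
  have hpR : (0 : ℝ) < p := by exact_mod_cast (Fact.out : p.Prime).pos
  have hR1 : (1 : ℝ) ≤ R := one_le_of_sandwich h1 hR
  by_cases hx : x = 0
  · subst hx; simp
  have hxpos : 0 < ‖x‖ := norm_pos_iff.mpr hx
  set k : ℤ := Int.clog p ‖x‖ with hk
  have hxle : ‖x‖ ≤ (p : ℝ) ^ k := Int.self_le_zpow_clog hp1 ‖x‖
  have hxgt : (p : ℝ) ^ (k - 1) < ‖x‖ := Int.zpow_pred_clog_lt_self hp1 hxpos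
  have hnormc : ‖((p : ℚ_[p]) ^ k)‖ = (p : ℝ) ^ (-k) := Padic.norm_p_zpow k
  have hy : ‖((p : ℚ_[p]) ^ k) • x‖ ≤ 1 := by
    rw [norm_smul, hnormc, zpow_neg, inv_mul_le_iff₀ (zpow_pos hpR k), mul_one]
    exact hxle
  have hyΛ : ((p : ℚ_[p]) ^ k) • x ∈ Λ.toIntSubmodule := by
    have hmem : ((p : ℚ_[p]) ^ k) • x ∈ (Λ : Set K) := h1 (by rwa [mem_closedBall, dist_zero_right])
    exact hmem
  have hφy : φ (((p : ℚ_[p]) ^ k) • x) ∈ Λ.toIntSubmodule := ((mem_latticeAut_iff φ).mp hφ _).mpr hyΛ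
  have hφy' : ‖φ (((p : ℚ_[p]) ^ k) • x)‖ ≤ R := by
    have hmem : φ (((p : ℚ_[p]) ^ k) • x) ∈ closedBall (0 : K) R := hR hφy
    rwa [mem_closedBall, dist_zero_right] at hmem
  rw [map_smul, norm_smul, hnormc, zpow_neg, inv_mul_le_iff₀ (zpow_pos hpR k)] at hφy'
  have hpk : (p : ℝ) ^ k = (p : ℝ) ^ (k - 1) * p := by
    conv_lhs => rw [← sub_add_cancel k 1]
    rw [zpow_add_one₀ hpR.ne']
  rw [hpk] at hφy'
  have hpRnn : 0 ≤ (p : ℝ) * R := by positivity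
  calc ‖φ x‖ ≤ (p : ℝ) ^ (k - 1) * p * R := hφy'
    _ = (p : ℝ) ^ (k - 1) * (p * R) := by ring
    _ ≤ ‖x‖ * (p * R) := mul_le_mul_of_nonneg_right hxgt.le hpRnn
    _ = p * R * ‖x‖ := by ring

/-- **[EssLgc] Example 3.5.1 (ii) (shell form)**: a lattice automorphism maps `closedBall 0 r` into `closedBall 0 (p·R·r)`
(shells `U(M,n)` are displaced by at most `s = 1 + log_p R` steps). [cite: Mochizuki2022EssLgc, Ex. 3.5.1 (ii) p. 102] -/
theorem image_closedBall_subset_of_mem_latticeAut {R : ℝ} {Λ : AddSubgroup K} (h1 : closedBall (0 : K) 1 ⊆ (Λ : Set K))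
    (hR : (Λ : Set K) ⊆ closedBall (0 : K) R) {φ : K ≃ₗ[ℚ_[p]] K} (hφ : φ ∈ latticeAut ℚ_[p] Λ.toIntSubmodule)
    (r : ℝ) : (φ : K → K) '' closedBall (0 : K) r ⊆ closedBall (0 : K) (p * R * r) := by
  rintro y ⟨x, hx, rfl⟩
  rw [mem_closedBall, dist_zero_right] at hx ⊢
  have hpRnn : 0 ≤ (p : ℝ) * R := by
    have := one_le_of_sandwich h1 hR
    positivity
  calc ‖φ x‖ ≤ p * R * ‖x‖ := norm_le_of_mem_latticeAut p h1 hR hφ x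
    _ ≤ p * R * r := mul_le_mul_of_nonneg_left hx hpRnn

/-- **[EssLgc] §3.5 (CnfInd1+2) at the p-adic model, depth explicit**: for `j ≥ 2`, once `‖q‖^{j²−1}·(p·R) < 1`, no automorphism of a
sandwiched lattice carries `closedBall 0 ‖q‖^{j²}` (the region of `q^{j²}`) ONTO `closedBall 0 ‖q‖` (the region of `q`): the
(Ind1)/(Ind2)-shape indeterminacy cannot «confuse» `q` with `q^{j²}`. Direction EXCLUDING; no side on where such an identification
does come from. [cite: Mochizuki2022EssLgc, §3.5 (CnfInd1+2) p. 101] -/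
theorem image_closedBall_pow_ne_of_depth {R : ℝ} {Λ : AddSubgroup K} (h1 : closedBall (0 : K) 1 ⊆ (Λ : Set K))
    (hR : (Λ : Set K) ⊆ closedBall (0 : K) R) {φ : K ≃ₗ[ℚ_[p]] K} (hφ : φ ∈ latticeAut ℚ_[p] Λ.toIntSubmodule)
    {q : K} (hq : 0 < ‖q‖) {j : ℕ} (hj : 2 ≤ j) (hdepth : ‖q‖ ^ (j ^ 2 - 1) * (p * R) < 1) :
    (φ : K → K) '' closedBall (0 : K) (‖q‖ ^ (j ^ 2)) ≠ closedBall (0 : K) ‖q‖ := by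
  intro heq
  have hsub := image_closedBall_subset_of_mem_latticeAut p h1 hR hφ (‖q‖ ^ (j ^ 2))
  rw [heq] at hsub
  have hqmem : q ∈ closedBall (0 : K) ‖q‖ := by simp
  have hle := hsub hqmem
  rw [mem_closedBall, dist_zero_right] at hle
  have hpos : 1 ≤ j ^ 2 := Nat.one_le_pow _ _ (by omega)
  have hj' : ‖q‖ ^ (j ^ 2) = ‖q‖ ^ (j ^ 2 - 1) * ‖q‖ := by
    rw [← pow_succ, Nat.sub_add_cancel hpos]
  rw [hj'] at hle
  have : (p : ℝ) * R * (‖q‖ ^ (j ^ 2 - 1) * ‖q‖) = (‖q‖ ^ (j ^ 2 - 1) * (p * R)) * ‖q‖ := by ring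
  rw [this] at hle
  have hlt : (‖q‖ ^ (j ^ 2 - 1) * (p * R)) * ‖q‖ < 1 * ‖q‖ := mul_lt_mul_of_pos_right hdepth hq
  rw [one_mul] at hlt
  exact absurd hle (not_le.mpr hlt)

end LatticeAutDiscrepancy

end Literature.IUT.LogVolume

end
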